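import Literature.Probability.LatticeModels.PoissonDelaunayIsingMeasurable
import Literature.Probability.LatticeModels.PoissonDelaunayIsing
import Literature.Probability.LatticeModels.TorusZeroMode
import Literature.Analysis.FunctionSpaces.PointConfigFactorialMeasure
import HarnessLib

/-!
# Finite-volume Poisson–Delaunay Ising expectations are measurable in the configuration

Topic `Probability/LatticeModels`; theorem-only companion of `PoissonDelaunayIsing.lean` (no
definitions, no named facts). For the finite-volume plus expectation `finVolExpect ω β Λ` of the
Ising model on the Delaunay graph of a locally finite configuration `ω` (`PoissonDelaunayIsing.lean`)
we prove that, read in the volume cut out by a bounded measurable set `U` at the (unique) nearest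
sites of marked points and cut off outside a measurable good event, it is a MEASURABLE function of
`ω` for the count σ-algebra (`measurable_finVolExpect_piecewise`). The device is a countable set of
finite TEMPLATES:

* `finVolExpect_eq_isingExpect_template` — TRANSPORT: if a labelling `a : Fin K → E` of distinct
  sites enumerates all sites in `U` and all their Delaunay neighbours, then the finite-volume plus
  expectation of a spin monomial on `delaunayGraph ω` equals the plus expectation on the finite
  template graph `SimpleGraph.fromRel R` on `Fin K` read off from the labelling (the tree's
  transport along local isomorphisms `isingExpect_plus_map`; Friedli–Velenik 2017 §3.1: `μ⁺_Λ`
  only depends on `(Λ ∪ ∂Λ, ℰ^b_Λ)`).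
* `exists_template` — when the Delaunay graph is locally finite every configuration matches some
  template (the volume and its outer Delaunay boundary are finite).
* `measurableSet_exists_template` — the event "some labelling by distinct sites matches the
  template `(K, R, cU, m)`" is measurable: the matching conditions are jointly measurable in
  (configuration, labelling) (`measurableSet_isDelaunayPair`, `measurableSet_isNearest` of
  `PoissonDelaunayIsingMeasurable.lean`, void events of parametrised sets), and sums over tuples of
  distinct sites of measurable functions are measurable (`PointConfig.measurable_tsum_tuples`,
  Last–Penrose 2017 Prop. 4.3).
* `measurable_finVolExpect_piecewise` — preimages are countable unions of matching events.

The a.e. measurability of the quenched correlator `quenchedCorr` is deduced in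
`PoissonDelaunayIsingQuenchedMeasurable.lean`.

## References

* S. Friedli, Y. Velenik, *Statistical mechanics of lattice systems*, CUP 2017, §3.1. [`FriedliVelenik2017`]
* G. Last, M. Penrose, *Lectures on the Poisson Process*, CUP 2017, Prop. 4.3. [`LastPenrose2017`]
-/

noncomputable section

open MeasureTheory Set Metric Filter TopologicalSpace
open scoped Topology ENNReal

namespace Literature.Probability.LatticeModels

open Literature.Analysis.FunctionSpaces

variable {E : Type*} [MetricSpace E]

/-! ### Transport to a finite template graph -/

section Template

/-- **Transport of the finite-volume plus expectation to a finite template.** Let `ω` have a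
locally finite Delaunay graph, let the volume `Λ` consist of the sites in `U`, and let
`a : Fin K → E` label distinct sites so that every site in `U` and every Delaunay neighbour
outside `U` of a labelled site in `U` is labelled; record which labels lie in `U` (`cU`), the
Delaunay adjacency of the labelled sites (`R`) and the labels of the marked vertices (`m`). Then
`⟨∏ᵣ σ_{v r}⟩⁺_{Λ;β,0}` on `delaunayGraph ω` equals the plus expectation of `∏ᵣ σ_{m r}` in the
volume `{i | cU i}` on the template graph `SimpleGraph.fromRel R` on `Fin K` (the labelling is a
local isomorphism at the volume; Friedli–Velenik 2017, §3.1: `μ⁺_Λ` only depends on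
`(Λ ∪ ∂Λ, ℰ^b_Λ)`; tree `isingExpect_plus_map`). [cite: FriedliVelenik2017, §3.1, Def. 3.3] -/
theorem finVolExpect_eq_isingExpect_template (ω : PointConfig E)
    (hLF : ∀ w, ((delaunayGraph (ω : Set E)).neighborSet w).Finite) (β : ℝ) {U : Set E}
    (Λ : Finset (ω : Set E)) (hΛ : ∀ w, w ∈ Λ ↔ (w : E) ∈ U) {n : ℕ} (v : Fin n → (ω : Set E))
    {K : ℕ} (R : Fin K → Fin K → Bool) (cU : Fin K → Bool) (m : Fin n → Fin K) (a : Fin K → E)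
    (ha : a ∈ PointConfig.tuples K ω) (h2 : ∀ i, a i ∈ U ↔ cU i = true)
    (h3 : ∀ b ∈ ω, b ∈ U → ∃ i, b = a i)
    (h4 : ∀ b ∈ ω, b ∉ U → (∃ i, cU i = true ∧ a i ≠ b ∧ IsDelaunayPair (ω : Set E) (a i) b) →
      ∃ i, b = a i)
    (h5 : ∀ i j, R i j = true ↔ (a i ≠ a j ∧ IsDelaunayPair (ω : Set E) (a i) (a j)))
    (h6 : ∀ r, (v r : E) = a (m r)) :
    finVolExpect ω β Λ (spinMonomial v) =
      isingExpect (SimpleGraph.fromRel fun i j : Fin K => R i j = true)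
        (Finset.univ.filter fun i => cU i = true) β 0 .plus (spinMonomial m) := by
  classical
  unfold finVolExpect
  rw [dif_pos hLF]
  letI : (delaunayGraph (ω : Set E)).LocallyFinite := fun w => (hLF w).fintype
  set G : SimpleGraph (Fin K) := SimpleGraph.fromRel fun i j : Fin K => R i j = true with hG
  -- the labelling as an embedding into the sites
  let φ : Fin K ↪ (ω : Set E) :=
    ⟨fun i => ⟨a i, ha.2 i⟩, fun i j hij => ha.1 (congrArg Subtype.val hij)⟩
  have hφ : ∀ i, (φ i : E) = a i := fun i => rfl
  have hRsymm : ∀ i j, R i j = true → R j i = true := fun i j h => by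
    rw [h5] at h ⊢
    exact ⟨h.1.symm, h.2.symm⟩
  have hRirr : ∀ i, ¬ R i i = true := fun i h => by
    rw [h5] at h
    exact h.1 rfl
  have hGadj : ∀ i j, G.Adj i j ↔ R i j = true := fun i j => by
    rw [hG, SimpleGraph.fromRel_adj]
    constructor
    · rintro ⟨-, h | h⟩
      exacts [h, hRsymm _ _ h]
    · intro h
      refine ⟨fun hij => hRirr j ?_, Or.inl h⟩
      rwa [hij] at h
  -- the volume is the image of the template volume
  have hΛeq : Λ = (Finset.univ.filter fun i => cU i = true).map φ := by
    ext w
    rw [hΛ, Finset.mem_map]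
    constructor
    · intro hw
      obtain ⟨i, hi⟩ := h3 w w.2 hw
      refine ⟨i, Finset.mem_filter.2 ⟨Finset.mem_univ _, (h2 i).1 (hi ▸ hw)⟩, Subtype.ext hi.symm⟩
    · rintro ⟨i, hi, rfl⟩
      exact (h2 i).2 (Finset.mem_filter.1 hi).2
  have hadj : ∀ i ∈ (Finset.univ.filter fun i => cU i = true), ∀ j,
      (delaunayGraph (ω : Set E)).Adj (φ i) (φ j) ↔ G.Adj i j := fun i _ j => by
    rw [delaunayGraph_adj, hGadj, h5, hφ, hφ]
    simp only [Ne, Subtype.ext_iff, hφ]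
  have hnb : ∀ i ∈ (Finset.univ.filter fun i => cU i = true), ∀ w : (ω : Set E),
      (delaunayGraph (ω : Set E)).Adj (φ i) w → ∃ j, φ j = w := fun i hi w hw => by
    rw [delaunayGraph_adj] at hw
    have hne : a i ≠ (w : E) := fun h => hw.1 (Subtype.ext h)
    by_cases hwU : (w : E) ∈ U
    · obtain ⟨j, hj⟩ := h3 w w.2 hwU
      exact ⟨j, Subtype.ext hj.symm⟩
    · obtain ⟨j, hj⟩ := h4 w w.2 hwU ⟨i, (Finset.mem_filter.1 hi).2, hne, hw.2⟩
      exact ⟨j, Subtype.ext hj.symm⟩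
  rw [hΛeq]
  convert isingExpect_plus_map φ hadj hnb β 0 (measurable_spinMonomial v) using 2
  funext σ
  simp only [spinMonomial]
  refine Finset.prod_congr rfl fun r _ => ?_
  have hv : v r = φ (m r) := Subtype.ext (h6 r)
  rw [hv, spinAt_extendAlong]

/-- **Every configuration with locally finite Delaunay graph matches a template**: if the sites in
`U` form a finite set and the marked vertices `v r` lie in `U`, there are `K`, a labelling
`a : Fin K → E` of distinct sites enumerating the sites in `U` and their outer Delaunay neighbours,
and the template data `(R, cU, m)` read off from it. [folklore] -/
theorem exists_template (ω : PointConfig E)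
    (hLF : ∀ w, ((delaunayGraph (ω : Set E)).neighborSet w).Finite) {U : Set E}
    (hfin : ((ω : Set E) ∩ U).Finite) {n : ℕ} (v : Fin n → (ω : Set E)) (hvU : ∀ r, (v r : E) ∈ U) :
    ∃ (K : ℕ) (R : Fin K → Fin K → Bool) (cU : Fin K → Bool) (m : Fin n → Fin K) (a : Fin K → E),
      a ∈ PointConfig.tuples K ω ∧ (∀ i, a i ∈ U ↔ cU i = true) ∧
      (∀ b ∈ ω, b ∈ U → ∃ i, b = a i) ∧
      (∀ b ∈ ω, b ∉ U → (∃ i, cU i = true ∧ a i ≠ b ∧ IsDelaunayPair (ω : Set E) (a i) b) →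
        ∃ i, b = a i) ∧
      (∀ i j, R i j = true ↔ (a i ≠ a j ∧ IsDelaunayPair (ω : Set E) (a i) (a j))) ∧
      (∀ r, (v r : E) = a (m r)) := by
  classical
  -- the sites in `U`, as sites
  have hS₁ : ({w : (ω : Set E) | (w : E) ∈ U}).Finite :=
    (hfin.preimage Subtype.val_injective.injOn).subset fun w hw => ⟨w.2, hw⟩
  -- the outer Delaunay boundary of the volume
  set S₂ : Set E := {b | b ∈ ω ∧ b ∉ U ∧
    ∃ p ∈ (ω : Set E) ∩ U, p ≠ b ∧ IsDelaunayPair (ω : Set E) p b} with hS₂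
  have hS₂fin : S₂.Finite := by
    refine (hS₁.biUnion fun w _ => ((hLF w).image Subtype.val)).subset ?_
    rintro b ⟨hb, -, p, ⟨hp, hpU⟩, hne, hdel⟩
    refine mem_iUnion₂.2 ⟨⟨p, hp⟩, hpU, ⟨b, hb⟩, ?_, rfl⟩
    rw [SimpleGraph.mem_neighborSet, delaunayGraph_adj]
    exact ⟨fun h => hne (congrArg Subtype.val h), hdel⟩
  set S : Set E := ((ω : Set E) ∩ U) ∪ S₂ with hS
  have hSfin : S.Finite := hfin.union hS₂fin
  have hSω : S ⊆ ω := by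
    rintro b (⟨hb, -⟩ | ⟨hb, -⟩) <;> exact hb
  set F : Finset E := hSfin.toFinset with hF
  set e : F ≃ Fin F.card := F.equivFin with he
  set a : Fin F.card → E := fun i => (e.symm i : E) with ha
  have haS : ∀ i, a i ∈ S := fun i => hSfin.mem_toFinset.1 (e.symm i).2
  have hainj : Function.Injective a := fun i j h => e.symm.injective (Subtype.ext h)
  have hsurj : ∀ b ∈ S, ∃ i, b = a i := fun b hb =>
    ⟨e ⟨b, hSfin.mem_toFinset.2 hb⟩, by rw [ha]; simp only [Equiv.symm_apply_apply]⟩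
  refine ⟨F.card, fun i j => decide (a i ≠ a j ∧ IsDelaunayPair (ω : Set E) (a i) (a j)),
    fun i => decide (a i ∈ U), fun r => e ⟨(v r : E), hSfin.mem_toFinset.2 (Or.inl ⟨(v r).2, hvU r⟩)⟩,
    a, ⟨hainj, fun i => hSω (haS i)⟩, fun i => by simp only [decide_eq_true_eq],
    fun b hb hbU => hsurj b (Or.inl ⟨hb, hbU⟩), ?_, fun i j => by simp only [decide_eq_true_eq],
    fun r => ?_⟩
  · rintro b hb hbU ⟨i, hi, hne, hdel⟩
    rw [decide_eq_true_eq] at hi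
    exact hsurj b (Or.inr ⟨hb, hbU, a i, ⟨hSω (haS i), hi⟩, hne, hdel⟩)
  · rw [ha]
    simp only [Equiv.symm_apply_apply]

end Template

/-! ### Measurability of the matching events and of the cut-off finite-volume expectation -/

section Measurable

variable [ProperSpace E] [SecondCountableTopology E] [MeasurableSpace E] [BorelSpace E]

omit [ProperSpace E] [SecondCountableTopology E] [MeasurableSpace E] [BorelSpace E] in
/-- `N_ω(s) = 0` iff no site lies in `s`. [folklore] -/
theorem count_eq_zero_iff_forall_notMem (ω : PointConfig E) (s : Set E) :
    ω.count s = 0 ↔ ∀ b ∈ ω, b ∉ s := by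
  rw [PointConfig.count, Set.encard_eq_zero, Set.eq_empty_iff_forall_notMem]
  simp only [mem_inter_iff, not_and, PointConfig.mem_carrier]

/-- `{a | P a ↔ c}` is measurable for measurable `P` and a constant proposition `c`. [folklore] -/
theorem measurableSet_setOf_iff_const {α : Type*} [MeasurableSpace α] {P : α → Prop}
    (hP : MeasurableSet {a | P a}) (c : Prop) : MeasurableSet {a | P a ↔ c} := by
  by_cases hc : c
  · simp only [hc, iff_true]
    exact hP
  · simp only [hc, iff_false]
    exact hP.compl

/-- **The template-matching event is measurable.** For a measurable `U`, marked points `x` and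
template data `(K, R, cU, m)`, the set of configurations admitting a labelling `a : Fin K → E` of
distinct sites with: `a i ∈ U ↔ cU i`; every site in `U` labelled; every Delaunay neighbour
outside `U` of a labelled site in `U` labelled; `R` the Delaunay adjacency of the labels; and
`a (m r)` a nearest site to `x r` — is measurable for the count σ-algebra (the conditions are
jointly measurable in `(ω, a)`; sums over tuples of distinct sites are measurable,
`PointConfig.measurable_tsum_tuples`, Last–Penrose 2017 Prop. 4.3). [cite: LastPenrose2017, Prop. 4.3] -/
theorem measurableSet_exists_template {U : Set E} (hU : MeasurableSet U) {n : ℕ} (x : Fin n → E)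
    (K : ℕ) (R : Fin K → Fin K → Bool) (cU : Fin K → Bool) (m : Fin n → Fin K) :
    MeasurableSet {ω : PointConfig E | ∃ a ∈ PointConfig.tuples K ω,
      (∀ i, a i ∈ U ↔ cU i = true) ∧
      (∀ b ∈ ω, b ∈ U → ∃ i, b = a i) ∧
      (∀ b ∈ ω, b ∉ U → (∃ i, cU i = true ∧ a i ≠ b ∧ IsDelaunayPair (ω : Set E) (a i) b) →
        ∃ i, b = a i) ∧
      (∀ i j, R i j = true ↔ (a i ≠ a j ∧ IsDelaunayPair (ω : Set E) (a i) (a j))) ∧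
      (∀ r, a (m r) ∈ ω ∧ ∀ q ∈ ω, dist (x r) (a (m r)) ≤ dist (x r) q)} := by
  classical
  have heval : ∀ i : Fin K, Measurable fun p : PointConfig E × (Fin K → E) => p.2 i := fun i =>
    (measurable_pi_apply i).comp measurable_snd
  have heval' : ∀ i : Fin K, Measurable fun r : (PointConfig E × (Fin K → E)) × E => r.1.2 i :=
    fun i => (heval i).comp measurable_fst
  -- the five matching conditions as measurable subsets of (configuration, labelling)
  set A₂ : Set (PointConfig E × (Fin K → E)) := ⋂ i, {p | p.2 i ∈ U ↔ cU i = true} with hA₂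
  set t₃ : Set ((PointConfig E × (Fin K → E)) × E) := {r | r.2 ∈ U} ∩ ⋂ i, {r | r.2 ≠ r.1.2 i}
    with ht₃
  set A₃ : Set (PointConfig E × (Fin K → E)) := {p | p.1.count (Prod.mk p ⁻¹' t₃) = 0} with hA₃
  set t₄ : Set ((PointConfig E × (Fin K → E)) × E) := ({r | r.2 ∉ U} ∩
    ⋃ i, ({r | cU i = true} ∩ {r | r.1.2 i ≠ r.2 ∧ IsDelaunayPair (r.1.1 : Set E) (r.1.2 i) r.2})) ∩
    ⋂ i, {r | r.2 ≠ r.1.2 i} with ht₄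
  set A₄ : Set (PointConfig E × (Fin K → E)) := {p | p.1.count (Prod.mk p ⁻¹' t₄) = 0} with hA₄
  set A₅ : Set (PointConfig E × (Fin K → E)) :=
    ⋂ i, ⋂ j, {p | (p.2 i ≠ p.2 j ∧ IsDelaunayPair (p.1 : Set E) (p.2 i) (p.2 j)) ↔ R i j = true}
    with hA₅
  set A₆ : Set (PointConfig E × (Fin K → E)) :=
    ⋂ r, {p | p.2 (m r) ∈ p.1 ∧ ∀ q ∈ p.1, dist (x r) (p.2 (m r)) ≤ dist (x r) q} with hA₆
  have hA₂m : MeasurableSet A₂ :=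
    MeasurableSet.iInter fun i => measurableSet_setOf_iff_const (heval i hU) _
  have ht₃m : MeasurableSet t₃ := (measurable_snd hU).inter
    (MeasurableSet.iInter fun i => (measurableSet_eq_fun measurable_snd (heval' i)).compl)
  have hA₃m : MeasurableSet A₃ := PointConfig.measurableSet_count_preimage_eq_zero ht₃m measurable_fst
  have ht₄m : MeasurableSet t₄ := by
    refine (((measurable_snd hU).compl).inter (MeasurableSet.iUnion fun i =>
      (MeasurableSet.const _).inter ?_)).inter
      (MeasurableSet.iInter fun i => (measurableSet_eq_fun measurable_snd (heval' i)).compl)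
    exact measurableSet_ne_and_isDelaunayPair (measurable_fst.comp measurable_fst) (heval' i)
      measurable_snd
  have hA₄m : MeasurableSet A₄ := PointConfig.measurableSet_count_preimage_eq_zero ht₄m measurable_fst
  have hA₅m : MeasurableSet A₅ := MeasurableSet.iInter fun i => MeasurableSet.iInter fun j =>
    measurableSet_setOf_iff_const
      (measurableSet_ne_and_isDelaunayPair measurable_fst (heval i) (heval j)) _
  have hA₆m : MeasurableSet A₆ := MeasurableSet.iInter fun r =>
    measurableSet_isNearest measurable_fst measurable_const (heval (m r))
  set Q : Set (PointConfig E × (Fin K → E)) := A₂ ∩ A₃ ∩ A₄ ∩ A₅ ∩ A₆ with hQ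
  have hQm : MeasurableSet Q := (((hA₂m.inter hA₃m).inter hA₄m).inter hA₅m).inter hA₆m
  -- sums over labellings by distinct sites
  have hg : Measurable fun p : PointConfig E × (Fin K → E) =>
      Q.indicator (fun _ => (1 : ℝ≥0∞)) p :=
    measurable_const.indicator hQm
  have hmeas : MeasurableSet {ω : PointConfig E |
      ∑' q : PointConfig.tuples K ω, Q.indicator (fun _ => (1 : ℝ≥0∞)) (ω, (q : Fin K → E)) ≠ 0} :=
    (PointConfig.measurable_tsum_tuples hg (measurableSet_singleton 0)).compl
  convert hmeas using 1
  ext ω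
  simp only [mem_setOf_eq, Ne, ENNReal.tsum_eq_zero, not_forall, Set.indicator_apply_eq_zero,
    one_ne_zero, imp_false, not_not, Subtype.exists, exists_prop]
  refine exists_congr fun a => and_congr Iff.rfl ?_
  simp only [hQ, hA₂, hA₃, hA₄, hA₅, hA₆, ht₃, ht₄, mem_inter_iff, mem_iInter, mem_setOf_eq,
    count_eq_zero_iff_forall_notMem, mem_preimage, mem_iUnion, not_and, not_forall,
    not_not, and_assoc]
  refine and_congr Iff.rfl (and_congr Iff.rfl (and_congr Iff.rfl (and_congr ?_ Iff.rfl)))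
  exact forall_congr' fun i => forall_congr' fun j => Iff.comm

/-- **The cut-off finite-volume plus expectation at the nearest sites is measurable.** Let `U` be
bounded measurable with `Λ ω` the sites of `ω` in `U`, and `S` a measurable event on which the
Delaunay graph is locally finite, each marked point `x r` has a UNIQUE nearest site `v ω r`, and
these lie in `U`. Then `ω ↦ ⟨∏ᵣ σ_{v ω r}⟩⁺_{Λ ω;β,0}` (and `c` off `S`) is measurable for the
count σ-algebra: on `S` its value on the matching event of a template is the template's value
(`finVolExpect_eq_isingExpect_template`), every `ω ∈ S` matches some template
(`exists_template`), templates form a countable set and matching events are measurable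
(`measurableSet_exists_template`). [folklore] -/
theorem measurable_finVolExpect_piecewise {U : Set E} (hU : MeasurableSet U)
    (hUb : Bornology.IsBounded U) (Λ : ∀ ω : PointConfig E, Finset (ω : Set E))
    (hΛ : ∀ ω w, w ∈ Λ ω ↔ (w : E) ∈ U) (β : ℝ) {n : ℕ} (x : Fin n → E)
    (v : ∀ ω : PointConfig E, (ω : Set E).Nonempty → Fin n → (ω : Set E))
    {S : Set (PointConfig E)} [DecidablePred (· ∈ S)] (hS : MeasurableSet S)
    (hSne : ∀ ω ∈ S, (ω : Set E).Nonempty)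
    (hLF : ∀ ω ∈ S, ∀ w, ((delaunayGraph (ω : Set E)).neighborSet w).Finite)
    (hv : ∀ ω (hω : ω ∈ S) r q, (q ∈ ω ∧ ∀ q' ∈ ω, dist (x r) q ≤ dist (x r) q') ↔
      q = (v ω (hSne ω hω) r : E))
    (hvU : ∀ ω (hω : ω ∈ S) r, (v ω (hSne ω hω) r : E) ∈ U) (c : ℝ) :
    Measurable fun ω =>
      if hω : ω ∈ S then finVolExpect ω β (Λ ω) (spinMonomial (v ω (hSne ω hω))) else c := by
  classical
  -- the sites in `U` form a finite set
  have hfin : ∀ ω : PointConfig E, ((ω : Set E) ∩ U).Finite := fun ω => by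
    rcases isEmpty_or_nonempty E with hE | ⟨⟨x₀⟩⟩
    · exact Set.toFinite _
    · obtain ⟨ρ, hρ⟩ := hUb.subset_closedBall x₀
      exact (ω.finite_inter_closedBall x₀ ρ).subset (inter_subset_inter_right _ hρ)
  -- templates, their values and their matching events
  set Φ : (Σ K : ℕ, (Fin K → Fin K → Bool) × (Fin K → Bool) × (Fin n → Fin K)) → ℝ := fun T =>
    isingExpect (SimpleGraph.fromRel fun i j : Fin T.1 => T.2.1 i j = true)
      (Finset.univ.filter fun i => T.2.2.1 i = true) β 0 .plus (spinMonomial T.2.2.2) with hΦ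
  set D : (Σ K : ℕ, (Fin K → Fin K → Bool) × (Fin K → Bool) × (Fin n → Fin K)) →
      Set (PointConfig E) := fun T => {ω | ∃ a ∈ PointConfig.tuples T.1 ω,
      (∀ i, a i ∈ U ↔ T.2.2.1 i = true) ∧
      (∀ b ∈ ω, b ∈ U → ∃ i, b = a i) ∧
      (∀ b ∈ ω, b ∉ U → (∃ i, T.2.2.1 i = true ∧ a i ≠ b ∧ IsDelaunayPair (ω : Set E) (a i) b) →
        ∃ i, b = a i) ∧
      (∀ i j, T.2.1 i j = true ↔ (a i ≠ a j ∧ IsDelaunayPair (ω : Set E) (a i) (a j))) ∧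
      (∀ r, a (T.2.2.2 r) ∈ ω ∧ ∀ q ∈ ω, dist (x r) (a (T.2.2.2 r)) ≤ dist (x r) q)} with hD
  have hDm : ∀ T, MeasurableSet (D T) := fun T =>
    measurableSet_exists_template hU x T.1 T.2.1 T.2.2.1 T.2.2.2
  have hval : ∀ T ω (hω : ω ∈ S), ω ∈ D T →
      finVolExpect ω β (Λ ω) (spinMonomial (v ω (hSne ω hω))) = Φ T := by
    rintro ⟨K, R, cU, m⟩ ω hω ⟨a, ha, h2, h3, h4, h5, h6⟩
    exact finVolExpect_eq_isingExpect_template ω (hLF ω hω) β (Λ ω) (hΛ ω) _ R cU m a ha h2 h3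
      h4 h5 fun r => ((hv ω hω r (a (m r))).1 (h6 r)).symm
  have hcov : ∀ ω (hω : ω ∈ S), ∃ T, ω ∈ D T := by
    intro ω hω
    obtain ⟨K, R, cU, m, a, ha, h2, h3, h4, h5, h6⟩ :=
      exists_template ω (hLF ω hω) (hfin ω) (v ω (hSne ω hω)) (hvU ω hω)
    exact ⟨⟨K, R, cU, m⟩, a, ha, h2, h3, h4, h5, fun r => by
      rw [← h6 r]; exact (hv ω hω r _).2 rfl⟩
  intro B hB
  have hpre : (fun ω => if hω : ω ∈ S then
      finVolExpect ω β (Λ ω) (spinMonomial (v ω (hSne ω hω))) else c) ⁻¹' B =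
      (S ∩ ⋃ T ∈ {T | Φ T ∈ B}, D T) ∪ (Sᶜ ∩ {_ω | c ∈ B}) := by
    ext ω
    simp only [mem_preimage, mem_union, mem_inter_iff, mem_iUnion, mem_setOf_eq, mem_compl_iff,
      exists_prop]
    by_cases hω : ω ∈ S
    · rw [dif_pos hω]
      simp only [hω, true_and, not_true_eq_false, false_and, or_false]
      constructor
      · intro hB'
        obtain ⟨T, hT⟩ := hcov ω hω
        exact ⟨T, by rwa [← hval T ω hω hT], hT⟩
      · rintro ⟨T, hTB, hT⟩
        rwa [hval T ω hω hT]
    · rw [dif_neg hω]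
      simp only [hω, false_and, false_or, not_false_eq_true, true_and]
  rw [hpre]
  exact (hS.inter (MeasurableSet.biUnion (Set.to_countable _) fun T _ => hDm T)).union
    (hS.compl.inter (MeasurableSet.const _))

end Measurable

end Literature.Probability.LatticeModels

end
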